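import Summits.QuantumFields.YangMills.Theorems.BrascampLiebVacuum.Negative.DmaxVolumeBound

/-!
# `ConvexGribovBody.BrascampLiebVacuumSC` — negative lemma: a volume-uniform admissible probe
# turns the crux into a floor on `Dmax` (refuter / standing disprover, crux stmt-QuantumFields-16404)

Modular core of `Negative/DmaxFloor.lean`. A **uniform admissible probe** at `(G, r)` is a family
of test functions `f_S` (one per torus `S ≥ 1`) that are (i) gauge invariant, (ii) time-zero local,
(iii) link-Lipschitz, with Dirichlet form `dir f_S ≤ k` and variance `Var_μ f_S ≥ v(β) > 0`
UNIFORMLY in `S` (crux vocabulary verbatim). The time-zero plaquette trace is one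
(`Negative/PlaquetteVarianceFloor.lean` + `Negative/PlaquetteDirichletBound.lean`; assembled in
`Negative/DmaxFloor.lean`). Here, with the probe as a hypothesis:

* `dmax_floor_of_brascampLiebVacuumSC_of_probe` — crux + probe at a simply-connected admissible
  `(G, r)` ⇒ for all `β ≥ β₀` there are `c(β) > 0`, `S₁(β)` with `Dmax(β, S) ≥ c(β)` for all
  `S ≥ S₁` (`c = v / (C · max k 1)`; uses `0 ≤ Dmax`).
* `brascampLiebVacuumSC_false_of_probe_of_dmaxDegenerate` — probe + degeneration of `Dmax`
  (`liminf_S Dmax(β, S) = 0` for cofinally many `β`) ⇒ ¬crux.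

Nothing here asserts a Theses statement positively; axioms `propext`, `Classical.choice`,
`Quot.sound`.
-/

noncomputable section

open scoped BigOperators Topology Matrix
open Filter MeasureTheory Function
open Literature.MathematicalPhysics.QuantumFieldTheory
open Summit.QuantumFields.YangMills.Theorems.BrascampLiebVacuum.Negative

namespace Summit.QuantumFields.YangMills.Theorems.BrascampLiebVacuumSC.Negative

/-- **Crux + uniform admissible probe ⇒ volume-uniform floor on `Dmax`.** [folklore] -/
theorem dmax_floor_of_brascampLiebVacuumSC_of_probe
    (hBL : Summit.QuantumFields.YangMills.Theses.ConvexGribovBody.BrascampLiebVacuumSC)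
    {G : Type} [Group G] [TopologicalSpace G] [IsTopologicalGroup G] [CompactSpace G]
    [MeasurableSpace G] [BorelSpace G] (hG : IsCompactSimpleLieGroup G) (hSC : SimplyConnectedSpace G)
    (r : LatticeRep G)
    (hprobe : (∃ k : ℝ, ∀ β : ℝ, ∃ v : ℝ, 0 < v ∧ ∀ S : ℕ, 1 ≤ S →
      let μ := wilsonMeasure (d := 4) (L := 2 * S + 1) r.ρ β
      let fro : Matrix (Fin r.N) (Fin r.N) ℂ → ℝ := fun M => ∑ a, ∑ b, ‖M a b‖ ^ 2
      let slope : (GaugeConfig 4 (2 * S + 1) G → ℝ) → GaugeConfig 4 (2 * S + 1) G →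
          Edge 4 (2 * S + 1) → ℝ := fun f U e =>
        Filter.limsup (fun g : G => |f (Function.update U e g) - f U| /
          Real.sqrt (fro (r.ρ g - r.ρ (U e)))) (𝓝[≠] (U e))
      let dir : (GaugeConfig 4 (2 * S + 1) G → ℝ) → ℝ := fun f =>
        ∑ e : Edge 4 (2 * S + 1), (if e.1 0 = 0 ∧ e.2 ≠ 0 then ∫ U, (slope f U e) ^ 2 ∂μ else 0)
      ∃ f : GaugeConfig 4 (2 * S + 1) G → ℝ, IsGaugeInvariant f ∧
        (∀ U V : GaugeConfig 4 (2 * S + 1) G,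
          (∀ e : Edge 4 (2 * S + 1), e.1 0 = 0 → e.2 ≠ 0 → U e = V e) → f U = f V) ∧
        (∃ K : ℝ, ∀ U V : GaugeConfig 4 (2 * S + 1) G,
          |f U - f V| ≤ K * ∑ e, Real.sqrt (fro (r.ρ (U e) - r.ρ (V e)))) ∧
        dir f ≤ k ∧ v ≤ ∫ U, (f U - ∫ V, f V ∂μ) ^ 2 ∂μ)) :
    ∃ β₀ : ℝ, ∀ β : ℝ, β₀ ≤ β → ∃ c : ℝ, 0 < c ∧ ∃ S₁ : ℕ, ∀ S : ℕ, S₁ ≤ S →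
    let μ := wilsonMeasure (d := 4) (L := 2 * S + 1) r.ρ β
    let fro : Matrix (Fin r.N) (Fin r.N) ℂ → ℝ := fun M => ∑ a, ∑ b, ‖M a b‖ ^ 2
    let coul : GaugeConfig 4 (2 * S + 1) G → (Site 4 (2 * S + 1) → G) → ℝ := fun U h =>
      -∑ e : Edge 4 (2 * S + 1),
        (if e.1 0 = 0 ∧ e.2 ≠ 0 then (r.ρ (gaugeTransform h U e)).trace.re else 0)
    let cov : GaugeConfig 4 (2 * S + 1) G → (Site 4 (2 * S + 1) → G) →
        (Fin 3 → ZMod (2 * S + 1)) → ℝ := fun U h p =>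
      (∑ j : Fin 3, fro (∑ y : Fin 3 → ZMod (2 * S + 1),
        Complex.exp (-(2 * Real.pi * Complex.I *
          (∑ i : Fin 3, ((p i).val : ℂ) * ((y i).val : ℂ)) / (2 * S + 1 : ℂ))) •
        ((1 / 2 : ℂ) • (r.ρ (gaugeTransform h U (Fin.cons (0 : ZMod (2 * S + 1)) y, j.succ)) -
          (r.ρ (gaugeTransform h U (Fin.cons (0 : ZMod (2 * S + 1)) y, j.succ)))ᴴ)))) /
        ((2 * S + 1 : ℝ) ^ 3)
    let Dmax : ℝ := ⨆ p : Fin 3 → ZMod (2 * S + 1),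
      ∫ U, (⨆ h : {h : Site 4 (2 * S + 1) → G // ∀ h', coul U h ≤ coul U h'}, cov U h.1 p) ∂μ
    c ≤ Dmax := by
  obtain ⟨β₀, hβ⟩ := hBL G hG hSC r
  obtain ⟨k, hk⟩ := hprobe
  refine ⟨β₀, fun β hb => ?_⟩
  obtain ⟨C, hC, S₀, hS₀⟩ := hβ β hb
  obtain ⟨v, hv, hvS⟩ := hk β
  have hk0 : 0 < max k 1 := lt_of_lt_of_le one_pos (le_max_right _ _)
  refine ⟨v / (C * max k 1), div_pos hv (mul_pos hC hk0), max S₀ 1, fun S hS => ?_⟩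
  intro μ fro coul cov Dmax
  obtain ⟨f, hf₁, hf₂, hf₃, hdir, hvar⟩ := hvS S (le_trans (le_max_right _ _) hS)
  have hbody := hS₀ S (le_trans (le_max_left _ _) hS) f hf₁ hf₂ hf₃
  have hD0 : 0 ≤ Dmax := by
    have hcov0 : ∀ U h p, 0 ≤ cov U h p := fun U h p => by
      refine div_nonneg (Finset.sum_nonneg fun j _ => ?_) (by positivity)
      exact Finset.sum_nonneg fun a _ => Finset.sum_nonneg fun b _ => by positivity
    exact Real.iSup_nonneg fun p => integral_nonneg fun U =>
      Real.iSup_nonneg fun h => hcov0 U h.1 p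
  have h1 : v ≤ C * Dmax * max k 1 := by
    refine hvar.trans (hbody.trans ?_)
    exact mul_le_mul_of_nonneg_left (hdir.trans (le_max_left _ _)) (mul_nonneg hC.le hD0)
  rw [div_le_iff₀ (mul_pos hC hk0)]
  calc v ≤ C * Dmax * max k 1 := h1
    _ = Dmax * (C * max k 1) := by ring

/-- **Uniform admissible probe + degeneration of `Dmax` ⇒ the SC crux is false.** [folklore] -/
theorem brascampLiebVacuumSC_false_of_probe_of_dmaxDegenerate
    {G : Type} [Group G] [TopologicalSpace G] [IsTopologicalGroup G] [CompactSpace G]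
    [MeasurableSpace G] [BorelSpace G] (hG : IsCompactSimpleLieGroup G) (hSC : SimplyConnectedSpace G)
    (r : LatticeRep G)
    (hprobe : (∃ k : ℝ, ∀ β : ℝ, ∃ v : ℝ, 0 < v ∧ ∀ S : ℕ, 1 ≤ S →
      let μ := wilsonMeasure (d := 4) (L := 2 * S + 1) r.ρ β
      let fro : Matrix (Fin r.N) (Fin r.N) ℂ → ℝ := fun M => ∑ a, ∑ b, ‖M a b‖ ^ 2
      let slope : (GaugeConfig 4 (2 * S + 1) G → ℝ) → GaugeConfig 4 (2 * S + 1) G →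
          Edge 4 (2 * S + 1) → ℝ := fun f U e =>
        Filter.limsup (fun g : G => |f (Function.update U e g) - f U| /
          Real.sqrt (fro (r.ρ g - r.ρ (U e)))) (𝓝[≠] (U e))
      let dir : (GaugeConfig 4 (2 * S + 1) G → ℝ) → ℝ := fun f =>
        ∑ e : Edge 4 (2 * S + 1), (if e.1 0 = 0 ∧ e.2 ≠ 0 then ∫ U, (slope f U e) ^ 2 ∂μ else 0)
      ∃ f : GaugeConfig 4 (2 * S + 1) G → ℝ, IsGaugeInvariant f ∧
        (∀ U V : GaugeConfig 4 (2 * S + 1) G,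
          (∀ e : Edge 4 (2 * S + 1), e.1 0 = 0 → e.2 ≠ 0 → U e = V e) → f U = f V) ∧
        (∃ K : ℝ, ∀ U V : GaugeConfig 4 (2 * S + 1) G,
          |f U - f V| ≤ K * ∑ e, Real.sqrt (fro (r.ρ (U e) - r.ρ (V e)))) ∧
        dir f ≤ k ∧ v ≤ ∫ U, (f U - ∫ V, f V ∂μ) ^ 2 ∂μ))
    (hD : ∀ β₀ : ℝ, ∃ β : ℝ, β₀ ≤ β ∧ ∀ c : ℝ, 0 < c → ∀ S₁ : ℕ, ∃ S : ℕ, S₁ ≤ S ∧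
      let μ := wilsonMeasure (d := 4) (L := 2 * S + 1) r.ρ β
      let fro : Matrix (Fin r.N) (Fin r.N) ℂ → ℝ := fun M => ∑ a, ∑ b, ‖M a b‖ ^ 2
      let coul : GaugeConfig 4 (2 * S + 1) G → (Site 4 (2 * S + 1) → G) → ℝ := fun U h =>
        -∑ e : Edge 4 (2 * S + 1),
          (if e.1 0 = 0 ∧ e.2 ≠ 0 then (r.ρ (gaugeTransform h U e)).trace.re else 0)
      let cov : GaugeConfig 4 (2 * S + 1) G → (Site 4 (2 * S + 1) → G) →
        (Fin 3 → ZMod (2 * S + 1)) → ℝ := fun U h p =>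
      (∑ j : Fin 3, fro (∑ y : Fin 3 → ZMod (2 * S + 1),
        Complex.exp (-(2 * Real.pi * Complex.I *
          (∑ i : Fin 3, ((p i).val : ℂ) * ((y i).val : ℂ)) / (2 * S + 1 : ℂ))) •
        ((1 / 2 : ℂ) • (r.ρ (gaugeTransform h U (Fin.cons (0 : ZMod (2 * S + 1)) y, j.succ)) -
          (r.ρ (gaugeTransform h U (Fin.cons (0 : ZMod (2 * S + 1)) y, j.succ)))ᴴ)))) /
        ((2 * S + 1 : ℝ) ^ 3)
      let Dmax : ℝ := ⨆ p : Fin 3 → ZMod (2 * S + 1),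
      ∫ U, (⨆ h : {h : Site 4 (2 * S + 1) → G // ∀ h', coul U h ≤ coul U h'}, cov U h.1 p) ∂μ
      Dmax < c) :
    ¬ Summit.QuantumFields.YangMills.Theses.ConvexGribovBody.BrascampLiebVacuumSC := by
  intro hBL
  obtain ⟨β₀, hβ⟩ := dmax_floor_of_brascampLiebVacuumSC_of_probe hBL hG hSC r hprobe
  obtain ⟨β, hb, hdeg⟩ := hD β₀
  obtain ⟨c, hc, S₁, hS₁⟩ := hβ β hb
  obtain ⟨S, hS, hlt⟩ := hdeg c hc S₁
  exact absurd (hS₁ S hS) (not_le.2 hlt)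

end Summit.QuantumFields.YangMills.Theorems.BrascampLiebVacuumSC.Negative

end
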